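import Summits.HodgeConjecture.HodgeConjecture.Theorems.NikulinTwinTransportHodgeSimilitudeAlgebraicPrimes
import Literature.AlgebraicGeometry.Surfaces.K3SurfaceProofs

/-!
# `HodgeSimilitudeAlgebraic` (stmt-HodgeConjecture-13676) · Negative · no anti-similitudes; the sign of the multiplier

Negative-side knowledge for the crux `NikulinTwinTransport.HodgeSimilitudeAlgebraic` (every rational
Hodge similitude of positive rational multiplier between projective K3 surfaces is algebraic),
extracted from the standing disprover's work file `Cruxes/HodgeSimilitudeAlgebraic/Disproof.lean`
(refuter-cdisprove-stmt-HodgeConjecture-13676-g3-0, cycle 2, 2026-08-16) so that provers and planners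
can import it. Two groups of unconditional theorems:

* THE SIGN OF THE MULTIPLIER IS DECORATION. The crux quantifies over both integral generators `p` of
  `H⁴(S(ℂ); ℤ) ≅ ℤ`; flipping `p ↦ -p` shows `SimAlgAt[-c] ↔ SimAlgAt[c]` (`simAlgAt_neg_iff`) and
  hence `HodgeSimilitudeAlgebraic ↔ ∀ r ≠ 0, SimAlgAt[r]` (`hodgeSimilitudeAlgebraic_iff_forall_ne_zero`):
  the hypothesis `0 < r` of the crux carries no content. No fact about K3 surfaces is used.
* NO ANTI-SIMILITUDES. Over an ordered field a linear map cannot multiply a form by `c < 0` when the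
  negative definite subspaces are too large (`no_antisimilitude_of_finrank_lt`, dimension count); the
  K3 lattice carries 19 pairwise orthogonal `(−2)`-vectors (an `A₁⁸ ⊂ E₈(−1)` in each block and
  `e − f` in each hyperbolic plane; Gram `−2·1` by `decide` blockwise, `negRows_k3Gram`), so the
  rational K3 form admits no anti-similitude of ANY negative multiplier
  (`k3FormRat_no_antisimilitude`, `22 < 19 + 19`; the tree's `not_antiIsometry_k3FormRat` is the
  multiplier `−1`), and on the real carriers a rational `ψ : H²(S′(ℂ);ℂ) → H²(S(ℂ);ℂ)` between marked
  K3 surfaces never satisfies the crux's similitude condition with a negative multiplier relative to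
  the marking generators (`no_antisimilitude_of_markings`). Consequently the branches
  `(p, p′) = (∓p₀, ±p₀′)` of the crux's `∀ p p′` are vacuous (with `eq_or_eq_neg_of_zsmul` and the
  marking fact), directly — without composing with a lattice similitude of the same multiplier as in
  `NikulinTwinTransportTwinSimilitudeAlgebraicTransfer`.

## References

* [Huybrechts2016K3] D. Huybrechts, Lectures on K3 Surfaces (2016), Ch. 1 Prop. 3.5, Ch. 14 §0.3 (vi).
* [Buskin2019] N. Buskin, Every rational Hodge isometry between two K3 surfaces is algebraic,
  J. reine angew. Math. 755 (2019), §6.2.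
-/

noncomputable section

open CategoryTheory MonoidalCategory
open scoped Manifold Matrix
open Literature.AlgebraicGeometry.Motives Literature.AlgebraicGeometry.HodgeTheory
open Literature.AlgebraicGeometry.Surfaces Literature.Geometry.Kaehler
open Literature.AlgebraicTopology.SingularHomology
open Summit.HodgeConjecture.HodgeConjecture.Theses.NikulinTwinTransport
open Summit.HodgeConjecture.HodgeConjecture.Theorems.NikulinTwinTransport

namespace Summit.HodgeConjecture.HodgeConjecture.Theorems.HodgeSimilitudeAlgebraic.Negative

/-! ### The sign of the multiplier -/

/-- `SimAlgAt[c]`: the crux at ONE multiplier `c : ℂ` — verbatim the local notation of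
`NikulinTwinTransportHodgeSimilitudeAlgebraicPrimes`. Local notation only. -/
local notation3 (prettyPrint := false) "SimAlgAt[" c "]" =>
  ∀ (μ : OrientationFamily), μ.HasPoincareDuality →
    ∀ (S S' : SchemeOver ℂ)
      (hS : (IsSmoothProjective 2 S ∧ Subsingleton (structureSheafCohomology S.left 1) ∧
        ∃ (A : HodgeModel 2 S) (η : MForm 𝓘(ℝ, A.model) A.carrier ℂ 2),
          IsHolomorphicInCharts η ∧ ∀ x, η x ≠ 0))
      (hS' : (IsSmoothProjective 2 S' ∧ Subsingleton (structureSheafCohomology S'.left 1) ∧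
        ∃ (A : HodgeModel 2 S') (η : MForm 𝓘(ℝ, A.model) A.carrier ℂ 2),
          IsHolomorphicInCharts η ∧ ∀ x, η x ≠ 0))
      (p : complexBetti S (2 * 2)) (p' : complexBetti S' (2 * 2)),
      (IsIntegralClass p ∧ ∀ q : complexBetti S (2 * 2), IsIntegralClass q → ∃ n : ℤ, q = n • p) →
      (IsIntegralClass p' ∧
        ∀ q : complexBetti S' (2 * 2), IsIntegralClass q → ∃ n : ℤ, q = n • p') →
      ∀ (ψ : complexBetti S' (2 * 1) →ₗ[ℂ] complexBetti S (2 * 1)),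
        (∀ x, IsRationalClass x → IsRationalClass (ψ x)) →
        (∀ (i j : ℕ) x, IsOfHodgeType 2 S' (2 * 1) i j x → IsOfHodgeType 2 S (2 * 1) i j (ψ x)) →
        (∀ (x y : complexBetti S' (2 * 1)) (a : ℂ),
          cupProduct (rfl : 2 * 1 + 2 * 1 = 2 * 2) x y = a • p' →
            cupProduct (rfl : 2 * 1 + 2 * 1 = 2 * 2) (ψ x) (ψ y) = (c * a) • p) →
        ∃ γ ∈ algebraicClasses (MonoidalCategoryStruct.tensorObj S S') 2,
          ∀ x : complexBetti S' (2 * 1),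
            ψ x = complexGysin μ (IsSmoothProjective.tensor_holds hS.1 hS'.1) hS.1
              (SemiCartesianMonoidalCategory.fst S S')
              (rfl : 2 * 1 + 2 * 2 + 2 * 2 = 2 * 1 + 2 * (2 + 2))
              (cupProduct (rfl : 2 * 1 + 2 * 2 = 2 * 1 + 2 * 2)
                (complexBetti.map (SemiCartesianMonoidalCategory.snd S S') (2 * 1) x) γ)

/-- If `p` is an integral generator of `H⁴(S(ℂ); ℤ)`, so is `-p`. [folklore] -/
theorem integralGenerator_neg {S : SchemeOver ℂ} {p : complexBetti S (2 * 2)}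
    (hp : IsIntegralClass p ∧ ∀ q : complexBetti S (2 * 2), IsIntegralClass q → ∃ n : ℤ, q = n • p) :
    IsIntegralClass (-p) ∧ ∀ q : complexBetti S (2 * 2), IsIntegralClass q → ∃ n : ℤ, q = n • (-p) := by
  refine ⟨?_, fun q hq => ?_⟩
  · have h := hp.1.zsmul (-1)
    simpa using h
  · obtain ⟨n, rfl⟩ := hp.2 q hq
    exact ⟨-n, by simp⟩

/-- **The sign of the multiplier carries no information**: `SimAlgAt[-c] ↔ SimAlgAt[c]`. The crux
quantifies over both integral generators `p` of `H⁴(S(ℂ); ℤ) ≅ ℤ`; replacing `p` by `-p` turns the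
similitude condition `(ψx.ψy) = (c·a)·p` into `((-c)·a)·(-p)` and leaves the conclusion (which does
not mention `p`) unchanged. No fact about K3 surfaces is used. [folklore] -/
theorem simAlgAt_neg_iff (c : ℂ) : SimAlgAt[-c] ↔ SimAlgAt[c] := by
  constructor
  · intro h μ hμ S S' hS hS' p p' hp hp' ψ hψr hψt hψs
    exact h μ hμ S S' hS hS' (-p) p' (integralGenerator_neg hp) hp' ψ hψr hψt fun x y a hxy => by
      rw [hψs x y a hxy, neg_mul, neg_smul, smul_neg, neg_neg]
  · intro h μ hμ S S' hS hS' p p' hp hp' ψ hψr hψt hψs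
    exact h μ hμ S S' hS hS' (-p) p' (integralGenerator_neg hp) hp' ψ hψr hψt fun x y a hxy => by
      rw [hψs x y a hxy, neg_mul, neg_smul, smul_neg]

/-- **`0 < r` is decoration**: the crux `HodgeSimilitudeAlgebraic` is equivalent to its extension
to ALL non-zero rational multipliers (`hodgeSimilitudeAlgebraic_iff_simAlgAt` + `simAlgAt_neg_iff`).
[folklore] -/
theorem hodgeSimilitudeAlgebraic_iff_forall_ne_zero :
    HodgeSimilitudeAlgebraic ↔ ∀ r : ℚ, r ≠ 0 → SimAlgAt[(r : ℂ)] := by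
  rw [hodgeSimilitudeAlgebraic_iff_simAlgAt]
  refine ⟨fun h r hr => ?_, fun h r hr => h r hr.ne'⟩
  rcases lt_or_gt_of_ne hr with hlt | hgt
  · have h' := h (-r) (neg_pos.2 hlt)
    rw [Rat.cast_neg] at h'
    exact (simAlgAt_neg_iff (r : ℂ)).1 h'
  · exact h r hgt

/-! ### No anti-similitudes -/


/-- **No anti-similitude (abstract; restores gen-2's lost lemma, now for every multiplier `c < 0`).**
Over an ordered field, if `N ≤ V` and `N' ≤ V'` are negative definite for the bilinear forms `B`,
`B'` and `dim V < dim N + dim N'`, then no linear `ψ : V' → V` satisfies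
`B(ψx, ψy) = c·B'(x, y)` with `c < 0`: `ψ` is injective on `N'`, `ψ(N')` is positive definite,
so `ψ(N') ∩ N = 0` and `dim N' + dim N ≤ dim V`. (The tree's `not_antiIsometry_k3FormRat` is the
case `c = -1`, `V = V' = Λ_ℚ`, `N = N' = E₈(−1)² ⊗ ℚ`.) [folklore] -/
theorem no_antisimilitude_of_finrank_lt {K V V' : Type*} [Field K] [LinearOrder K] [IsStrictOrderedRing K]
    [AddCommGroup V] [Module K V] [AddCommGroup V'] [Module K V'] [FiniteDimensional K V]
    (B : LinearMap.BilinForm K V) (B' : LinearMap.BilinForm K V')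
    (N : Submodule K V) (N' : Submodule K V')
    (hN : ∀ x ∈ N, x ≠ 0 → B x x < 0) (hN' : ∀ x ∈ N', x ≠ 0 → B' x x < 0)
    (hdim : Module.finrank K V < Module.finrank K N + Module.finrank K N')
    {c : K} (hc : c < 0) (ψ : V' →ₗ[K] V) (hψ : ∀ x y, B (ψ x) (ψ y) = c * B' x y) : False := by
  set f : N' →ₗ[K] V := ψ ∘ₗ N'.subtype with hf
  have hfx : ∀ x : N', f x = ψ (x : V') := fun x => rfl
  -- `ψ` is injective on `N'`
  have hinj : Function.Injective f := by
    rw [← LinearMap.ker_eq_bot, Submodule.eq_bot_iff]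
    intro x hx
    rw [LinearMap.mem_ker, hfx] at hx
    by_contra hne
    have hxV : (x : V') ≠ 0 := fun h => hne (Subtype.ext h)
    have hneg : B' (x : V') (x : V') < 0 := hN' _ x.2 hxV
    have h := hψ (x : V') (x : V')
    rw [hx] at h
    simp only [map_zero] at h
    have hzero : B' (x : V') (x : V') = 0 := by
      rcases mul_eq_zero.1 h.symm with h1 | h1
      · exact absurd h1 hc.ne
      · exact h1
    exact hneg.ne hzero
  have hP : Module.finrank K (LinearMap.range f) = Module.finrank K N' :=
    LinearMap.finrank_range_of_inj hinj
  -- the image of `N'` is positive definite, hence meets `N` trivially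
  have hPN : LinearMap.range f ⊓ N = ⊥ := by
    rw [Submodule.eq_bot_iff]
    rintro v ⟨⟨x, rfl⟩, hvN⟩
    by_contra hv
    have h1 : B (f x) (f x) < 0 := hN _ hvN hv
    have hxV : (x : V') ≠ 0 := by
      intro hx0
      apply hv
      rw [hfx, hx0, map_zero]
    have h2 : B' (x : V') (x : V') < 0 := hN' _ x.2 hxV
    have h3 : B (f x) (f x) = c * B' (x : V') (x : V') := by rw [hfx]; exact hψ _ _
    have h4 : 0 < c * B' (x : V') (x : V') := mul_pos_of_neg_of_neg hc h2
    rw [← h3] at h4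
    exact lt_asymm h1 h4
  have hsum := Submodule.finrank_sup_add_finrank_inf_eq (LinearMap.range f) N
  rw [hPN, finrank_bot, add_zero, hP] at hsum
  have hle := Submodule.finrank_le (LinearMap.range f ⊔ N)
  omega

/-! ### 19 pairwise orthogonal `(-2)`-vectors of the K3 lattice -/

/-- Index type of the 19 vectors: 8 + 8 roots in the two `E₈(−1)` blocks, one vector `e − f` in
each hyperbolic plane. Local notation only. -/
local notation3 (prettyPrint := false) "NegIndex" => (Fin 8 ⊕ Fin 8) ⊕ (Fin 1 ⊕ (Fin 1 ⊕ Fin 1))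

/-- Eight pairwise orthogonal roots of `E₈` (rows, in the simple-root coordinates of Mathlib's
Bourbaki Cartan matrix `CartanMatrix.E₈`): `α₈, α₆, α₄, α₁` and four higher positive roots — an
`A₁⁸ ⊂ E₈`; `R E₈ Rᵀ = 2·1` (`e8Roots_gram`). Local notation only.
[cite: Huybrechts2016K3, Ch. 14 §0.1 (the E₈ lattice)] -/
local notation3 (prettyPrint := false) "e8Roots" =>
  (!![0, 0, 0, 0, 0, 0, 0, 1;
      0, 0, 0, 0, 0, 1, 0, 0;
      0, 0, 0, 1, 0, 0, 0, 0;
      1, 0, 0, 0, 0, 0, 0, 0;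
      1, 2, 2, 3, 2, 1, 0, 0;
      1, 2, 2, 3, 2, 2, 2, 1;
      1, 2, 2, 4, 4, 3, 2, 1;
      2, 2, 4, 5, 4, 3, 2, 1] : Matrix (Fin 8) (Fin 8) ℤ)

/-- The vector `e − f` of the hyperbolic plane (square `−2`), as a `1 × 2` row. Local notation only. -/
local notation3 (prettyPrint := false) "uNeg" => (!![1, -1] : Matrix (Fin 1) (Fin 2) ℤ)

/-- The eight roots are pairwise orthogonal of square `2`: `R E₈ Rᵀ = 2·1`. [cite: Huybrechts2016K3, Ch. 14 §0.1 (the E₈ lattice)] -/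
theorem e8Roots_gram : e8Roots * CartanMatrix.E₈ * e8Rootsᵀ = (2 : ℤ) • 1 := by decide

/-- `(e − f)² = −2` in the hyperbolic plane. [cite: Huybrechts2016K3, Ch. 14 §0.3] -/
theorem uNeg_gram : uNeg * hyperbolicPlaneGram * uNegᵀ = (-2 : ℤ) • 1 := by decide

/-- `c • 1 = fromBlocks (c • 1) 0 0 (c • 1)` on a sum index type. [folklore] -/
theorem smul_one_fromBlocks {p q : Type*} [DecidableEq p] [DecidableEq q] (c : ℤ) :
    Matrix.fromBlocks (c • (1 : Matrix p p ℤ)) 0 0 (c • (1 : Matrix q q ℤ)) =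
      c • (1 : Matrix (p ⊕ q) (p ⊕ q) ℤ) := by
  rw [← Matrix.fromBlocks_one, Matrix.fromBlocks_smul, smul_zero, smul_zero]

/-- The 19 vectors as the rows of a block-diagonal `19 × 22` integer matrix (blocks `E₈`, `E₈`, `U`,
`U`, `U` of `k3Gram`). Local notation only. -/
local notation3 (prettyPrint := false) "negRows" =>
  (Matrix.fromBlocks (Matrix.fromBlocks e8Roots 0 0 e8Roots) 0 0
    (Matrix.fromBlocks uNeg 0 0 (Matrix.fromBlocks uNeg 0 0 uNeg)) : Matrix NegIndex K3Index ℤ)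

/-- **Gram matrix `−2·1`**: the 19 rows of `negRows` are pairwise orthogonal of square `−2` in the K3
lattice `Λ_{K3} = E₈(−1)² ⊕ U³` (a negative definite sublattice of the maximal rank `19`).
[cite: Huybrechts2016K3, Ch. 14 §0.3 (vi)] -/
theorem negRows_k3Gram : negRows * k3Gram * negRowsᵀ = (-2 : ℤ) • 1 := by
  have h8 : e8Roots * (-CartanMatrix.E₈) * e8Rootsᵀ = (-2 : ℤ) • 1 := by
    rw [Matrix.mul_neg, Matrix.neg_mul, e8Roots_gram, ← neg_smul]
  simp only [k3Gram, Matrix.fromBlocks_transpose, Matrix.fromBlocks_multiply,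
    Matrix.transpose_zero, Matrix.mul_zero, Matrix.zero_mul, add_zero, zero_add, h8, uNeg_gram,
    smul_one_fromBlocks]

/-! ### The rational K3 form admits no anti-similitude -/

/-- The 19 vectors over `ℚ` (rows). Local notation only. -/
local notation3 (prettyPrint := false) "negRowsQ" => (negRows).map (Int.cast : ℤ → ℚ)

/-- The Gram identity over `ℚ`. [cite: Huybrechts2016K3, Ch. 14 §0.3 (vi)] -/
theorem negRowsQ_gram : negRowsQ * k3Gram.map (Int.cast : ℤ → ℚ) * negRowsQᵀ = (-2 : ℚ) • 1 := by
  have h := congrArg (fun A : Matrix NegIndex NegIndex ℤ => A.map (Int.castRingHom ℚ)) negRows_k3Gram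
  rw [Matrix.map_mul, Matrix.map_mul, Matrix.transpose_map] at h
  have h1 : ((-2 : ℤ) • (1 : Matrix NegIndex NegIndex ℤ)).map (Int.castRingHom ℚ) =
      (-2 : ℚ) • (1 : Matrix NegIndex NegIndex ℚ) := by
    ext i j
    simp only [Matrix.map_apply, Matrix.smul_apply, Matrix.one_apply, smul_eq_mul, mul_ite, mul_one,
      mul_zero]
    split_ifs <;> simp
  rw [h1, Int.coe_castRingHom] at h
  exact h

/-- The span `N` of the 19 vectors: the range of `c ↦ Rᵀ c`. Local notation only. -/
local notation3 (prettyPrint := false) "negSpan" =>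
  (LinearMap.range (Matrix.mulVecLin (negRowsQ)ᵀ) : Submodule ℚ (K3Index → ℚ))

/-- `(Rᵀ c) (G Rᵀ) = −2 c`. [folklore] -/
theorem vecMul_gram (c : NegIndex → ℚ) :
    (negRowsQᵀ *ᵥ c) ᵥ* (k3Gram.map (Int.cast : ℤ → ℚ) * negRowsQᵀ) = (-2 : ℚ) • c := by
  rw [Matrix.mulVec_transpose, Matrix.vecMul_vecMul, ← Matrix.mul_assoc, negRowsQ_gram,
    Matrix.vecMul_smul, Matrix.vecMul_one]

/-- The K3 form on the span: `(Rᵀc . Rᵀc) = −2 (c.c)`. [folklore] -/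
theorem k3FormRat_negVec (c : NegIndex → ℚ) :
    k3FormRat (negRowsQᵀ *ᵥ c) (negRowsQᵀ *ᵥ c) = (-2 : ℚ) * (c ⬝ᵥ c) := by
  rw [k3FormRat, Matrix.toBilin'_apply', Matrix.mulVec_mulVec, Matrix.dotProduct_mulVec, vecMul_gram,
    smul_dotProduct, smul_eq_mul]

/-- `c ↦ Rᵀ c` is injective (the Gram matrix `−2·1` is invertible). [folklore] -/
theorem mulVec_negRowsQ_injective : Function.Injective (Matrix.mulVecLin (negRowsQ)ᵀ) := by
  intro c d hcd
  change negRowsQᵀ *ᵥ c = negRowsQᵀ *ᵥ d at hcd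
  have hc := vecMul_gram c
  rw [hcd, vecMul_gram d] at hc
  have h := congrArg (fun v => (-2 : ℚ)⁻¹ • v) hc
  simpa [smul_smul] using h.symm

/-- The span has dimension `19`. [folklore] -/
theorem finrank_negSpan : Module.finrank ℚ negSpan = 19 := by
  rw [LinearMap.finrank_range_of_inj mulVec_negRowsQ_injective,
    Module.finrank_fintype_fun_eq_card]
  rfl

/-- The span is negative definite. [cite: Huybrechts2016K3, Ch. 14 §0.3 (vi)] -/
theorem negSpan_neg (x : K3Index → ℚ) (hx : x ∈ negSpan) (hx0 : x ≠ 0) : k3FormRat x x < 0 := by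
  obtain ⟨c, rfl⟩ := hx
  change k3FormRat (negRowsQᵀ *ᵥ c) (negRowsQᵀ *ᵥ c) < 0
  rw [k3FormRat_negVec]
  have hc : c ≠ 0 := by
    rintro rfl
    exact hx0 (by simp)
  have hpos : 0 < c ⬝ᵥ c := by
    rw [dotProduct]
    obtain ⟨i, hi⟩ := Function.ne_iff.1 hc
    refine lt_of_lt_of_le (mul_self_pos.2 hi) ?_
    exact Finset.single_le_sum (f := fun j => c j * c j) (fun j _ => mul_self_nonneg (c j))
      (Finset.mem_univ i)
  linarith

/-- **The rational K3 form admits no anti-similitude of ANY negative multiplier**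
(`22 < 19 + 19`; generalises the tree's `not_antiIsometry_k3FormRat`, multiplier `-1`). Hence a
rational `ψ` between marked K3 surfaces never satisfies the crux's similitude condition with a
negative multiplier relative to the marking generators (`no_antisimilitude_of_markings`): the
branches `(p, p′) = (∓p₀, ±p₀′)` of the crux's `∀ p p′` are VACUOUS, and together with
`simAlgAt_neg_iff` this closes the "sign" rows of the load-bearing table without the
`N ∘ σ`-trick of the Transfer file (which needs a lattice similitude of the same multiplier).
[cite: Huybrechts2016K3, Ch. 14 §0.3 (vi) (signature (3,19))] -/
theorem k3FormRat_no_antisimilitude {c : ℚ} (hc : c < 0)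
    (ψ : (K3Index → ℚ) →ₗ[ℚ] (K3Index → ℚ))
    (hψ : ∀ x y, k3FormRat (ψ x) (ψ y) = c * k3FormRat x y) : False :=
  no_antisimilitude_of_finrank_lt k3FormRat k3FormRat negSpan negSpan negSpan_neg negSpan_neg
    (by rw [finrank_k3Rat, finrank_negSpan]; norm_num) hc ψ hψ

/-- **No rational anti-similitude between marked K3 surfaces** (real carriers; markings as DATA —
for actual K3 surfaces they come from the named fact `Huybrechts_K3_marking_exists`). If
`ψ : H²(S′(ℂ);ℂ) → H²(S(ℂ);ℂ)` maps rational classes to rational classes and satisfies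
`(x.y) = a·p₀′ ⟹ (ψx.ψy) = (c·a)·p₀` for the marking generators `p₀, p₀′` and a rational `c < 0`,
contradiction: `σ = η ∘ ψ ∘ η′⁻¹` is defined over `ℚ` (`markingConj_intCast`) and multiplies the
K3 form by `c` (`k3Form_markingConj_signed`), against `k3FormRat_no_antisimilitude`.
[cite: Buskin2019, §6.2 (isometries induced via markings)] -/
theorem no_antisimilitude_of_markings {S S' : Literature.AlgebraicGeometry.Motives.SchemeOver ℂ}
    (hS : IsK3Surface S)
    (η : Literature.AlgebraicGeometry.HodgeTheory.complexBetti S (2 * 1) ≃ₗ[ℂ] (K3Index → ℂ))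
    (p₀ : Literature.AlgebraicGeometry.HodgeTheory.complexBetti S (2 * 2)) (hp₀ : p₀ ≠ 0)
    (hη : ∀ c : Literature.AlgebraicGeometry.HodgeTheory.complexBetti S (2 * 1),
      Literature.AlgebraicGeometry.HodgeTheory.IsIntegralClass c ↔ ∃ v : K3Index → ℤ, η c = fun i => (v i : ℂ))
    (hηcup : ∀ a b : Literature.AlgebraicGeometry.HodgeTheory.complexBetti S (2 * 1),
      Literature.AlgebraicTopology.SingularHomology.cupProduct (rfl : 2 * 1 + 2 * 1 = 2 * 2) a b =
        k3Form (η a) (η b) • p₀)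
    (η' : Literature.AlgebraicGeometry.HodgeTheory.complexBetti S' (2 * 1) ≃ₗ[ℂ] (K3Index → ℂ))
    (p₀' : Literature.AlgebraicGeometry.HodgeTheory.complexBetti S' (2 * 2))
    (hη' : ∀ c : Literature.AlgebraicGeometry.HodgeTheory.complexBetti S' (2 * 1),
      Literature.AlgebraicGeometry.HodgeTheory.IsIntegralClass c ↔ ∃ v : K3Index → ℤ, η' c = fun i => (v i : ℂ))
    (hη'cup : ∀ a b : Literature.AlgebraicGeometry.HodgeTheory.complexBetti S' (2 * 1),
      Literature.AlgebraicTopology.SingularHomology.cupProduct (rfl : 2 * 1 + 2 * 1 = 2 * 2) a b =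
        k3Form (η' a) (η' b) • p₀')
    (ψ : Literature.AlgebraicGeometry.HodgeTheory.complexBetti S' (2 * 1) →ₗ[ℂ]
      Literature.AlgebraicGeometry.HodgeTheory.complexBetti S (2 * 1))
    (hψr : ∀ x, Literature.AlgebraicGeometry.HodgeTheory.IsRationalClass x →
      Literature.AlgebraicGeometry.HodgeTheory.IsRationalClass (ψ x))
    {c : ℚ} (hc : c < 0)
    (hψs : ∀ (x y : Literature.AlgebraicGeometry.HodgeTheory.complexBetti S' (2 * 1)) (a : ℂ),
      Literature.AlgebraicTopology.SingularHomology.cupProduct (rfl : 2 * 1 + 2 * 1 = 2 * 2) x y = a • p₀' →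
        Literature.AlgebraicTopology.SingularHomology.cupProduct (rfl : 2 * 1 + 2 * 1 = 2 * 2) (ψ x) (ψ y) =
          ((c : ℂ) * a) • p₀) : False := by
  -- `σ = η ∘ ψ ∘ η'⁻¹` is defined over `ℚ` and multiplies the K3 form by `c`
  set σ : Module.End ℂ (K3Index → ℂ) := η.toLinearMap ∘ₗ ψ ∘ₗ η'.symm.toLinearMap with hσ
  have hrat := markingConj_intCast hS η hη η' hη' ψ hψr
  have hform : ∀ a b, k3Form (σ a) (σ b) = (c : ℂ) * k3Form a b := by
    intro a b
    have h := k3Form_markingConj_signed η p₀ ((c : ℂ) • p₀) hp₀ (c : ℂ) rfl hηcup η' p₀' p₀' 1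
      (by rw [one_smul]) hη'cup ψ (fun x y a hxy => by rw [hψs x y a hxy, smul_smul, mul_comm a (c : ℂ)]) a b
    rw [h]
    ring
  obtain ⟨τ, hτ⟩ := exists_ratEnd_of_forall_intCast σ hrat
  refine k3FormRat_no_antisimilitude hc τ fun a b => ?_
  apply Rat.cast_injective (α := ℂ)
  rw [Rat.cast_mul, ← k3Form_ratCast, ← k3Form_ratCast, ← hτ a, ← hτ b, hform]


end Summit.HodgeConjecture.HodgeConjecture.Theorems.HodgeSimilitudeAlgebraic.Negative

end
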